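import Summits.QuantumFields.YangMills.Theorems.PoincareLipschitzLeungXinGraphStabilitySlackFlat
import Summits.QuantumFields.YangMills.Theorems.PoincareLipschitzFlatOrganOfFlatCapped
import HarnessLib

/-!
# Crux `HistoryTailL` (stmt-QuantumFields-19936), K2 organ of record `hImproveCoreFlat` (FROZEN v1 bac8eda3) ∕ residue `hHalvingBand` — supplier side:
# ★★ THE CACCIOPPOLI–STABILITY INEQUALITY IN THE FLAT ORGAN'S OWN LETTERS — A SUB-BOX ENERGY BOUND AT EVERY SCALE FROM THE
# `δ(ρ+1)`-ALMOST-MINIMALITY ROW ALONE (the lattice substitute for the monotonicity upper bound, for `S³`-valued maps)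

Cell `ym3-torus` (YM ladder rung R3 = continuum SU(2) Yang–Mills on the three-torus — a RUNG, NOT the Clay problem: not d = 4, not infinite volume,
not a mass gap); width seat `ym-ust-19936-w2` gen 12 ((S)-slack scope, LEAD w1 g9 2026-08-29T09:18:48Z).  THEOREMS ONLY, def-free; imports
✓`…LeungXinGraphStabilitySlackFlat` (✓p714160 `stability_caccioppoli_box_slack`) + ✓`…FlatOrganOfFlatCapped` (★w3 g14 ✓p715759:
`sum_corr_varied_le_add_of_almostMin`, `energy_box_eq_sum_dot_flat`) + HarnessLib.
* ★★ `energy_subbox_le_of_flatRow` — unit `u : ℤ³ → S³ ⊂ E⁴` satisfying the FROZEN flat organ's almost-minimality row (slack `δ(ρ+1)`) on the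
  sub-boxes of `Q_{4k+1}(z)`, `1 ≤ k`, `0 < |t| ≤ 1`:
  `E(Q_{k−1}(z)) ≤ 2250k + 4δ(4k+1)∕t² + 3t²·(2250k + 5·E(Q_{4k+1}(z)))`
  (✓`stability_caccioppoli_box_slack` at `d = 3`, `ρ = s = k`, slack `σ = δ(4k+1)∕2` supplied by ✓`sum_corr_varied_le_add_of_almostMin`;
  capacity `6(4k+1)³∕k² ≤ 750k`).  NO energy hypothesis: the right side carries the energy of the FOUR-TIMES LARGER box with the small factor `15t²`.
* ★★ `energy_subbox_le_of_flatRow_eighth` — the hole-filling form at `t² = 1∕120`: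
  `E(Q_{k−1}(z)) ≤ 2307k + 480δ(4k+1) + E(Q_{4k+1}(z))∕8` — iterable down the scales from the organ's top bound `E(Q_R) ≤ ΛR`
  (ratio `4 · (1∕8) = 1∕2 < 1`), giving `E(Q_r(z′)) ≤ C(Λ)·r` on every sub-box — the upper density bound that monotonicity would give in the
  continuum, here from stability + almost-minimality (Schoen–Uhlenbeck 1982 §2 for exact minimisers; the slack costs `O(δk)`).
HONEST: finite-dimensional algebra over landed rows; nothing of `hImproveCoreFlat`, `hHalvingBand`, K1, `MeanDeviationL`, `HistoryTailL` is proved here.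

References: R. Schoen, K. Uhlenbeck, J. Diff. Geom. **17** (1982) 307–335 [SchoenUhlenbeck1982] §2–§4 (stability∕Caccioppoli inequality for
minimisers into spheres, hole filling); Y.L. Xin, Duke Math. J. **47** (1980) 609–613 [Xin1980]; M. Giaquinta, *Multiple integrals in the
calculus of variations and nonlinear elliptic systems* (1983) [Giaquinta1984] Ch. III §2 (hole filling ∕ Widman).
-/

set_option autoImplicit false

noncomputable section

open scoped BigOperators InnerProductSpace
open Finset Matrix WithLp

namespace Summit.QuantumFields.YangMills.Theorems.PoincareLipschitzFlatRowCaccioppoliSlack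

open Literature.MathematicalPhysics.QuantumFieldTheory.Balaban1983to89.B4Eq19LatticeOperators
  (Zd unitVec box mem_box box_mono add_unitVec_mem_box)
open Summit.QuantumFields.YangMills.Theorems.PoincareLipschitzLeungXinGraphStabilitySlackFlat (stability_caccioppoli_box_slack)
open Summit.QuantumFields.YangMills.Theorems.PoincareLipschitzFlatOrganOfFlatCapped
  (sum_corr_varied_le_add_of_almostMin energy_box_eq_sum_dot_flat)
open Summit.QuantumFields.YangMills.Theorems.PoincareLipschitzEuclideanTwistDictionary (dot_self_eq_one_of_norm)

/-- Capacity arithmetic: `6(4k+1)³∕k² ≤ 750k` for `k ≥ 1` (since `4k+1 ≤ 5k`). [folklore] -/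
theorem cap_le (k : ℕ) (hk : 1 ≤ k) :
    2 * ((3 : ℕ) : ℝ) * ((2 * ((k : ℤ) + (k : ℤ)) + 1 : ℤ) : ℝ) ^ 3 / ((k : ℤ) : ℝ) ^ 2 ≤ 750 * (k : ℝ) := by
  have hk1 : (1 : ℝ) ≤ k := by exact_mod_cast hk
  have hkpos : (0 : ℝ) < k := by linarith
  have hcast : ((2 * ((k : ℤ) + (k : ℤ)) + 1 : ℤ) : ℝ) = 4 * (k : ℝ) + 1 := by push_cast; ring
  have hk' : ((k : ℤ) : ℝ) = (k : ℝ) := by push_cast; ring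
  rw [hcast, hk', div_le_iff₀ (by positivity)]
  have h5 : 4 * (k : ℝ) + 1 ≤ 5 * k := by linarith
  have h0 : 0 ≤ 4 * (k : ℝ) + 1 := by linarith
  calc 2 * ((3 : ℕ) : ℝ) * (4 * (k : ℝ) + 1) ^ 3 ≤ 2 * ((3 : ℕ) : ℝ) * (5 * k) ^ 3 := by gcongr
    _ = 750 * (k : ℝ) * (k : ℝ) ^ 2 := by push_cast; ring

/-- ★★ **THE CACCIOPPOLI–STABILITY INEQUALITY IN THE FLAT ORGAN'S LETTERS (every scale, almost-minimisers).**  Let `u : ℤ³ → S³ ⊂ E⁴` be unit and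
satisfy the frozen flat organ's almost-minimality row — `E(u; Q_{ρ+1}(z′)) ≤ E(v; Q_{ρ+1}(z′)) + δ(ρ+1)` for unit competitors `v` agreeing with `u`
off `Q_ρ(z′)` — on the sub-boxes `Q_{ρ+1}(z′) ⊆ Q_{4k+1}(z)`, `k ≥ 1`.  Then for every `0 < |t| ≤ 1`:
`E(Q_{k−1}(z)) ≤ 2250k + 4δ(4k+1)∕t² + 3t²(2250k + 5E(Q_{4k+1}(z)))`, `E(Q_r(z)) = Σ_{y ∈ Q_r(z)} Σ_μ ‖u(y+e_μ) − u(y)‖²`.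
(✓`stability_caccioppoli_box_slack` at `d = 3`, `ρ = s = k`; the correlation slack `δ(4k+1)∕2` from ✓`sum_corr_varied_le_add_of_almostMin` at
`(z, 4k+1, M := k)`; `e ≤ e(1+e∕2)`; bonds from `Q_{k−1}` end in `Q_k`.) [cite: SchoenUhlenbeck1982, §2; Xin1980, p.609–613] -/
theorem energy_subbox_le_of_flatRow (u : Zd 3 → EuclideanSpace ℝ (Fin 4)) (hu : ∀ y, ‖u y‖ = 1)
    (z : Zd 3) (k : ℕ) (hk : 1 ≤ k) {δ : ℝ}
    (halmost : ∀ (z' : Zd 3) (ρ : ℤ), 0 ≤ ρ → box z' (ρ + 1) ⊆ box z (4 * (k : ℤ) + 1) →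
        ∀ v : Zd 3 → EuclideanSpace ℝ (Fin 4), (∀ y, y ∉ box z' ρ → v y = u y) → (∀ y ∈ box z' ρ, ‖v y‖ = 1) →
        ∑ y ∈ box z' (ρ + 1), ∑ μ : Fin 3, ‖u (y + unitVec μ) - u y‖ ^ 2 ≤
        (∑ y ∈ box z' (ρ + 1), ∑ μ : Fin 3, ‖v (y + unitVec μ) - v y‖ ^ 2) + δ * ((ρ : ℝ) + 1))
    {t : ℝ} (ht : t ≠ 0) (ht1 : t ^ 2 ≤ 1) :
    ∑ y ∈ box z ((k : ℤ) - 1), ∑ μ : Fin 3, ‖u (y + unitVec μ) - u y‖ ^ 2 ≤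
      2250 * (k : ℝ) + 4 * δ * (4 * (k : ℝ) + 1) / t ^ 2 +
        3 * t ^ 2 * (2250 * (k : ℝ) + 5 * ∑ y ∈ box z (4 * (k : ℤ) + 1), ∑ μ : Fin 3, ‖u (y + unitVec μ) - u y‖ ^ 2) := by
  classical
  have hR : (1 : ℤ) ≤ 4 * (k : ℤ) + 1 := by omega
  have h2MR : 2 * (k : ℤ) ≤ 4 * (k : ℤ) + 1 - 1 := by omega
  have hu' : ∀ x, dotProduct (ofLp (u x)) (ofLp (u x)) = 1 := fun x => dot_self_eq_one_of_norm (hu x)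
  -- the correlation-form slack hypothesis of ✓`stability_caccioppoli_box_slack` from the organ's row (★w3's §1)
  have hmin : ∀ η : Zd 3 → ℝ, (∀ y ∉ box z ((k : ℤ) + (k : ℤ)), η y = 0) → (∀ y, 0 ≤ η y) → (∀ y, η y ≤ 1) → ∀ (a : Fin 4) (t : ℝ),
      ∑ b ∈ (box z (4 * (k : ℤ) + 1)) ×ˢ (Finset.univ : Finset (Fin 3)), dotProduct
        ((Real.sqrt (1 + t ^ 2 * dotProduct (η b.1 • (Pi.single a 1 - dotProduct (Pi.single a 1) (ofLp (u b.1)) • ofLp (u b.1)))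
            (η b.1 • (Pi.single a 1 - dotProduct (Pi.single a 1) (ofLp (u b.1)) • ofLp (u b.1)))))⁻¹ •
          (ofLp (u b.1) + t • (η b.1 • (Pi.single a 1 - dotProduct (Pi.single a 1) (ofLp (u b.1)) • ofLp (u b.1)))))
        ((Real.sqrt (1 + t ^ 2 * dotProduct (η (b.1 + unitVec b.2) •
              (Pi.single a 1 - dotProduct (Pi.single a 1) (ofLp (u (b.1 + unitVec b.2))) • ofLp (u (b.1 + unitVec b.2))))
            (η (b.1 + unitVec b.2) • (Pi.single a 1 - dotProduct (Pi.single a 1) (ofLp (u (b.1 + unitVec b.2))) • ofLp (u (b.1 + unitVec b.2))))))⁻¹ •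
          (ofLp (u (b.1 + unitVec b.2)) + t • (η (b.1 + unitVec b.2) •
            (Pi.single a 1 - dotProduct (Pi.single a 1) (ofLp (u (b.1 + unitVec b.2))) • ofLp (u (b.1 + unitVec b.2)))))) ≤
      (∑ b ∈ (box z (4 * (k : ℤ) + 1)) ×ˢ (Finset.univ : Finset (Fin 3)), dotProduct (ofLp (u b.1)) (ofLp (u (b.1 + unitVec b.2)))) +
        δ * ((4 * (k : ℤ) + 1 : ℤ) : ℝ) / 2 := by
    intro η hη _ _ a t'
    have hη' : ∀ y ∉ box z (2 * (k : ℤ)), η y = 0 := fun y hy => hη y (by rwa [← two_mul])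
    have h := sum_corr_varied_le_add_of_almostMin u hu z (4 * (k : ℤ) + 1) hR k h2MR halmost η hη' a t'
    rw [Finset.sum_product, Finset.sum_product]
    exact h
  have hmain := stability_caccioppoli_box_slack ((box z (4 * (k : ℤ) + 1)) ×ˢ (Finset.univ : Finset (Fin 3)))
    (fun x => ofLp (u x)) hu' z (ρ := (k : ℤ)) (s := (k : ℤ)) (by positivity) (by exact_mod_cast hk) hmin ht ht1
  beta_reduce at hmain
  -- clean the right side
  have hcap := cap_le k hk
  have hk' : ((k : ℤ) : ℝ) = (k : ℝ) := by push_cast; ring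
  have hX : ((4 * (k : ℤ) + 1 : ℤ) : ℝ) = 4 * (k : ℝ) + 1 := by push_cast; ring
  have hδeq : 8 * (δ * ((4 * (k : ℤ) + 1 : ℤ) : ℝ) / 2) / t ^ 2 = 4 * δ * (4 * (k : ℝ) + 1) / t ^ 2 := by rw [hX]; ring
  have hcap' : 3 * (2 * ((3 : ℕ) : ℝ) * ((2 * ((k : ℤ) + (k : ℤ)) + 1 : ℤ) : ℝ) ^ 3) / ((k : ℤ) : ℝ) ^ 2 ≤ 2250 * (k : ℝ) := by
    rw [mul_div_assoc]; linarith
  have ht2 : 0 ≤ 3 * t ^ 2 := by positivity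
  set S : ℝ := ∑ b ∈ (box z (4 * (k : ℤ) + 1)) ×ˢ (Finset.univ : Finset (Fin 3)),
    dotProduct (ofLp (u b.1) - ofLp (u (b.1 + unitVec b.2))) (ofLp (u b.1) - ofLp (u (b.1 + unitVec b.2))) with hS
  have hin : 3 * (2 * ((3 : ℕ) : ℝ) * ((2 * ((k : ℤ) + (k : ℤ)) + 1 : ℤ) : ℝ) ^ 3 / ((k : ℤ) : ℝ) ^ 2) + 5 * S ≤ 2250 * (k : ℝ) + 5 * S := by
    linarith
  have hout := mul_le_mul_of_nonneg_left hin ht2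
  -- the left side dominates `E(Q_{k−1}(z))`
  have he0 : ∀ b : Zd 3 × Fin 3, 0 ≤ dotProduct (ofLp (u b.1) - ofLp (u (b.1 + unitVec b.2))) (ofLp (u b.1) - ofLp (u (b.1 + unitVec b.2))) :=
    fun b => by
    simp only [dotProduct, Pi.sub_apply]
    exact Finset.sum_nonneg fun i _ => mul_self_nonneg _
  have hTsub : (box z ((k : ℤ) - 1)) ×ˢ (Finset.univ : Finset (Fin 3)) ⊆
      ((box z (4 * (k : ℤ) + 1)) ×ˢ (Finset.univ : Finset (Fin 3))).filter
        (fun b => b.1 ∈ box z (k : ℤ) ∧ b.1 + unitVec b.2 ∈ box z (k : ℤ)) := by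
    intro b hb
    rw [Finset.mem_product] at hb
    rw [Finset.mem_filter, Finset.mem_product]
    have hb1 : b.1 ∈ box z ((k : ℤ) - 1) := hb.1
    refine ⟨⟨box_mono z (by omega) hb1, Finset.mem_univ _⟩, box_mono z (by omega) hb1, ?_⟩
    have h := add_unitVec_mem_box hb1 b.2
    rwa [sub_add_cancel] at h
  calc ∑ y ∈ box z ((k : ℤ) - 1), ∑ μ : Fin 3, ‖u (y + unitVec μ) - u y‖ ^ 2
        = ∑ b ∈ (box z ((k : ℤ) - 1)) ×ˢ (Finset.univ : Finset (Fin 3)),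
            dotProduct (ofLp (u b.1) - ofLp (u (b.1 + unitVec b.2))) (ofLp (u b.1) - ofLp (u (b.1 + unitVec b.2))) :=
          energy_box_eq_sum_dot_flat u z ((k : ℤ) - 1)
    _ ≤ ∑ b ∈ ((box z (4 * (k : ℤ) + 1)) ×ˢ (Finset.univ : Finset (Fin 3))).filter
            (fun b => b.1 ∈ box z (k : ℤ) ∧ b.1 + unitVec b.2 ∈ box z (k : ℤ)),
            dotProduct (ofLp (u b.1) - ofLp (u (b.1 + unitVec b.2))) (ofLp (u b.1) - ofLp (u (b.1 + unitVec b.2))) :=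
          Finset.sum_le_sum_of_subset_of_nonneg hTsub fun b _ _ => he0 b
    _ ≤ ∑ b ∈ ((box z (4 * (k : ℤ) + 1)) ×ˢ (Finset.univ : Finset (Fin 3))).filter
            (fun b => b.1 ∈ box z (k : ℤ) ∧ b.1 + unitVec b.2 ∈ box z (k : ℤ)),
            dotProduct (ofLp (u b.1) - ofLp (u (b.1 + unitVec b.2))) (ofLp (u b.1) - ofLp (u (b.1 + unitVec b.2))) *
              (1 + dotProduct (ofLp (u b.1) - ofLp (u (b.1 + unitVec b.2))) (ofLp (u b.1) - ofLp (u (b.1 + unitVec b.2))) / 2) :=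
          Finset.sum_le_sum fun b _ => by nlinarith [he0 b]
    _ ≤ 2250 * (k : ℝ) + 4 * δ * (4 * (k : ℝ) + 1) / t ^ 2 + 3 * t ^ 2 * (2250 * (k : ℝ) + 5 * S) := by
          linarith [hmain, hcap', hδeq.le, hδeq.ge, hout]
    _ = _ := by rw [hS, ← energy_box_eq_sum_dot_flat u z (4 * (k : ℤ) + 1)]

/-- ★★ **HOLE-FILLING FORM** (`t² = 1∕120`): `E(Q_{k−1}(z)) ≤ 2307k + 480δ(4k+1) + E(Q_{4k+1}(z))∕8` for a unit `u : ℤ³ → S³` satisfying the flat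
organ's almost-minimality row on the sub-boxes of `Q_{4k+1}(z)`, `k ≥ 1`.  Iterating from the organ's top bound `E(Q_R) ≤ ΛR` down the scales
`k ↦ 4k+2` (ratio `(1∕8)·O(4) < 1`) bounds `E(Q_r(z′))∕r` on every sub-box by a constant `C(Λ)` — the lattice substitute, for `S³`-valued
almost-minimisers, of the monotonicity upper bound. [cite: SchoenUhlenbeck1982, §2; Giaquinta1984, Ch. III §2] -/
theorem energy_subbox_le_of_flatRow_eighth (u : Zd 3 → EuclideanSpace ℝ (Fin 4)) (hu : ∀ y, ‖u y‖ = 1)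
    (z : Zd 3) (k : ℕ) (hk : 1 ≤ k) {δ : ℝ} (hδ : 0 ≤ δ)
    (halmost : ∀ (z' : Zd 3) (ρ : ℤ), 0 ≤ ρ → box z' (ρ + 1) ⊆ box z (4 * (k : ℤ) + 1) →
        ∀ v : Zd 3 → EuclideanSpace ℝ (Fin 4), (∀ y, y ∉ box z' ρ → v y = u y) → (∀ y ∈ box z' ρ, ‖v y‖ = 1) →
        ∑ y ∈ box z' (ρ + 1), ∑ μ : Fin 3, ‖u (y + unitVec μ) - u y‖ ^ 2 ≤
        (∑ y ∈ box z' (ρ + 1), ∑ μ : Fin 3, ‖v (y + unitVec μ) - v y‖ ^ 2) + δ * ((ρ : ℝ) + 1)) :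
    ∑ y ∈ box z ((k : ℤ) - 1), ∑ μ : Fin 3, ‖u (y + unitVec μ) - u y‖ ^ 2 ≤
      2307 * (k : ℝ) + 480 * δ * (4 * (k : ℝ) + 1) +
        (∑ y ∈ box z (4 * (k : ℤ) + 1), ∑ μ : Fin 3, ‖u (y + unitVec μ) - u y‖ ^ 2) / 8 := by
  obtain ⟨t, ht⟩ : ∃ t : ℝ, t ^ 2 = 1 / 120 := ⟨Real.sqrt (1 / 120), Real.sq_sqrt (by norm_num)⟩
  have ht0 : t ≠ 0 := by
    intro h
    rw [h] at ht
    norm_num at ht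
  have h := energy_subbox_le_of_flatRow u hu z k hk halmost ht0 (by rw [ht]; norm_num)
  rw [ht] at h
  have hE0 : 0 ≤ ∑ y ∈ box z (4 * (k : ℤ) + 1), ∑ μ : Fin 3, ‖u (y + unitVec μ) - u y‖ ^ 2 :=
    Finset.sum_nonneg fun y _ => Finset.sum_nonneg fun μ _ => by positivity
  have hk0 : (0 : ℝ) ≤ k := by positivity
  have hδk : 0 ≤ δ * (4 * (k : ℝ) + 1) := mul_nonneg hδ (by linarith)
  have e1 : 4 * δ * (4 * (k : ℝ) + 1) / (1 / 120) = 480 * δ * (4 * (k : ℝ) + 1) := by ring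
  rw [e1] at h
  linarith

end Summit.QuantumFields.YangMills.Theorems.PoincareLipschitzFlatRowCaccioppoliSlack

end
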